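import Summits.CriticalPhenomena.SAWScalingLimit.Theses.SAWDefectDecoherence

/-!
# Skeleton line `dressed-arrival-cauchy-transform` for crux `BoundaryClosureR` (stmt-CriticalPhenomena-14004) — generation 2

Route `SAWDefectDecoherence`, crux r4
`BoundaryClosureR := DefectDecoherence → MassRatio → HexObservableLimitR` — the boundary
Riemann–Hilbert half of Duminil-Copin–Smirnov's Conjecture 2 GIVEN the route's two exponent
cruxes, over the REPAIRED target `HexObservableLimitR` (root `a` and normaliser `b` both pinned
conformally: flat horizontal half-plane piece + exact half-lattice `{v | m i δ ≤ v.1 1}` inside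
`ball (pt i) ρ`).

## The line (idea `dressed-arrival-cauchy-transform`, ideator 2 gen 2; triage r1: 3 × pass; gen-2 reshaping)

LEVER (unchanged).  The exact discrete Cauchy–Pompeiu identity (any `G : ℂ → ℂ`; interior edges
cancel, `G(c_v)·(vertex relation) = 0`)
`Σ_{e ∈ ∂Ω_δ} (mid e − c_v) G(δ·mid e) F_δ(e) = Σ_{v ∈ Λ_δ} Σ_{t ∼ v} (mid − c_v)(G(δ·mid) − G(δc_v)) F_δ(vt)`,
whose left side is the pairing of `G` with the PHASE-DRESSED BOUNDARY ARRIVAL MEASURE (each atom =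
positive arrival mass `Z_δ(e)` × an exact lattice phase, by winding rigidity) and whose right side
is, per vertex, `δ(ℓ/2)²[e^{3iα_v}(2/ℓ) ∂G·T(v) + ∂̄G·S(v)] + O(δ²|∇²G| M_v)` with
`T(v) = Σ_t conj(mid − c_v)F(vt)` EXACTLY the route's vertex-star curl defect (`DefectDecoherence`),
`S(v) = Σ_t F(vt)` the signal and `M_v` the star mass (`ℓ = 1/√3`).

WHAT GENERATION 2 CHANGES (planner findings, see `Lines/dressed-arrival-cauchy-transform.md`).
(1) Gen 1 pushed the identity to the WHOLE lattice boundary; its compactness/trace engine needed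
the GLOBAL tightness `δΣ_∂|δe − a'|Z(e) ≤ C Z(b)`, which is conjecturally FALSE at the crux's
generality (multifractal carriers, cascading collars: triage r1-1 (iii), gen-1 Idea (a)), and the
global trace was not consumed by the closing.  (2) Gen 2 LOCALISES the identity to the two RIGID
GATES (the exact half-lattice balls at `b` and at the root), where every boundary mid-edge is a
vertical dangling edge of ONE class: there the dressed measure is `(−iℓ/2) × phase × λ_δ` with
`λ_δ := δ Σ_{gate e} (Z_δ(e)/Z_δ(b_δ)) δ_{δe}` a POSITIVE measure, tight for EVERY admissible family
(flat exact gate), and `phase` locally constant and exactly known (`1` on `b`'s component, flip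
`e^{−5πi/4}` left-vs-right of a root).  (3) With test functions
`g̃(x + iy) = Σ_{j ≤ k} (iy)^j g₀^{(j)}(x)/j!` (so `∂̄g̃ = O(y^k)` in the gate layer) the
thin-layer signal term is `≤ M·O(η^k)` where `M` is only the BOUNDEDNESS constant of
`δ²Σ_{gate ball}|F_δ|/|F_δ(b_δ)|` (`GateL1Bound`); every weak limit `f` is `L¹` up to the gate, hence
of polynomial growth, hence has a distributional boundary value on the open gate, and the identity
says that boundary value IS `2√3 × phase × λ` (a positive measure times a constant: `2/ℓ = 2√3`,
the constant predicted by cards runge-gated-green-pairing / polygon-squeeze-flux-trace).  (4) Since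
that boundary distribution is a REAL measure after conjugating the constant phase, `f` and its
mirror image `conj f(conj ·)` have EQUAL boundary distributions on the gate, so their distributional
`∂̄` vanishes across it (the two one-sided boundary terms cancel) and Weyl's lemma CONTINUES `f`
ANALYTICALLY ACROSS BOTH GATES (edge-of-the-wedge; the local F. and M. Riesz theorem is the
alternative route), with `f = 2√3·λ'·phase` on them — so `λ` is absolutely continuous with a
real-analytic density, `> 0` given flat ratio continuity; at the root the two phases and the branch
`(z − x)^{5/4}` make `q := (z − x)^{5/4}ū₀f` real `≥ 0` on both sides, `L¹` kills poles of order
`≥ 2`, positivity kills the simple pole, so `f(z)(z − x)^{5/4} → κ` EXISTS, and `κ ≠ 0` follows from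
a positive-mass LOWER bound on near-root arrivals.  So the flat trace (`FlatTrace`, two-root's open
stub) and the boundary/order clauses of `IsCupLimit` are OUTPUTS of the line (stub 4), for every
Jordan carrier and every admissible collar — the card's item 3(c)/item 4 made carrier-blind.
(5) Identification still needs the second root (the half-CR barrier's kernel = boundary-modulus
freedom of one root on the rough arcs): the closing is the audited two-root quotient
(`RatioContinuity`, `FlatLocality`, arc constancy exact, root-ratio law, reciprocity, reflection),
stub 7.

STUBS.  1 `stub_gateRepresentation` (L; identity + exact gate phases + bookkeeping at the cut:
bulk curl pairing by `DefectDecoherence`+`MassRatio`, gate collars by the positive-mass laws) ·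
2 `stub_positiveMassLaws` (L, open, Φ-free UPPER bounds at the gates only: collar budget, total
mass, tightness) · 3 `stub_l1Control` (L–XL, open: `LocalL1Bound` on compacts — necessary for the
target by Banach–Steinhaus — and its gate version `GateL1Bound`, boundedness only) ·
4 `stub_gateTrace` (L, classical: compactness, boundary values of polynomially bounded holomorphic
functions, Weyl, reflection, Laurent) · 5 `stub_lowerBounds` (XL, HARDEST: zero-freeness of bulk limits, near-root arrival lower
bound) · 6 `stub_ratioLaws` (L, open: two-root `RatioContinuity`, one-root `FlatRatioContinuity` on
the gates, `FlatLocality`) · 7 `stub_closing` (L, classical given 4–6).  `closing` and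
`BoundaryClosureR_of` are sorry-free; `BoundaryClosureR_of` concludes the crux BY NAME.

## Disproof / negatives used (`Cruxes/BoundaryClosureR/Disproof.lean`, cdisprove cycle 1, re-read at start)
* (F0/F3) no `_false_without_` on the crux side; DD, MR are proof devices: they enter stub 1
  (bulk curl pairing, interior masses) and stub 5 (lower bounds) — `not_crux_iff`.
* (F2) `target_false_without_rootPin`: honoured at STUBS 1–2 — the gate identity at the root and
  `GateTightness`/`RootGateLowerBound` are statements about the EXACT half-lattice ball at the
  root; in the corridor-at-the-root family there is no such ball and the near-root arrival profile
  is that of the corridor tip.  `target_false_without_normaliserPin`: honoured at STUB 4/6 — the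
  universal constant `K = 2√3` is `2√3 × (arrival density at b = 1 per unit length)`, i.e.
  `FlatRatioContinuity` at `b` in the exact zigzag class; a dead-end corridor ending at `b_δ`
  rescales `F(b_δ)` alone and breaks exactly this.
* (F4) the redundant `Nonempty` clause of the frame is not used (two-root vocabulary).  (F5) the
  audited continuum picture is respected verbatim: root-ratio law with the pole at the auxiliary
  root, `(1 − Φ/t)^{−5/4}` the continuous branch, phase flip `e^{−5πi/4}` across a root (this file's
  `gatePhase`), `FlatTrace` disjointness clause.  (F6a) all `b`-inputs inside the rigid ball with
  margins `ρ' < ρ`; (F6b) armchair pieces: the frame pins `b` on the one-class zigzag row.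
* Landed negatives `Theorems/BoundaryClosureR/Negative/{RootPin,NormaliserPin,EndCorridor,PeelEnd,
  ShiftedHalfDisc}`, `SAWDefectDecoherenceHexObservableLimit_refuted`: no stub is an instance
  (every statement is over `AdmissibleFamily` + `PinnedFlatRoot`, both pins, eventual in `δ`).
  `ledger negatives` (5420, 8312, 0772, 8261, percolation/Cardy items): no all-δ quantifier,
  constants per connected carrier and per pinned point, nothing restated.
-/

noncomputable section

open scoped BigOperators ComplexConjugate Topology Classical
open Filter Set MeasureTheory
open Literature.Probability.LatticeModels Literature.Probability.RandomPlanarGeometry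
open Literature.Probability.RandomPlanarGeometry.SAW
open Summit.CriticalPhenomena.SAWScalingLimit.Theses.SAWDefectDecoherence

namespace Summit.CriticalPhenomena.SAWScalingLimit.Cruxes.BoundaryClosureR.DressedArrivalCauchyTransform

/-! ### 1. Vocabulary

`NF`, `arrivalMass`, `IsTest`, `AdmissibleFamily`, `PinnedFlatRoot`, `IsWeakLimit`, `flatPoints`,
`IsCupLimit` are VERBATIM the vocabulary of `Lines/two-root-quotient` and `Lines/pick-half-plane`
(so that `LocalL1Bound`, `RatioContinuity`, `FlatLocality`, `FlatTrace`, `CupLimits`,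
`Identification` below are literally their statements); the rest is this line's. -/

/-- The normalised functional `N^{e}_δ(ψ) := δ² Σ_{z ∈ Ω_δ} ψ(δ·mid z) F^{e δ}(z) / F^{e δ}(b δ)`
(root family `e`, normalisation family `b`, spin `5/8`, fugacity `x_c`). -/
def NF (Λ : ℝ → Finset HexVertex) (e b : ℝ → Sym2 HexVertex) (δ : ℝ) (ψ : ℂ → ℂ) : ℂ :=
  (δ : ℂ) ^ 2 * (∑ᶠ z ∈ hexDomainMidEdges (Λ δ),
      ψ ((δ : ℂ) * hexMidpoint z) * hexParafermionicObservable (Λ δ) (e δ) hexCriticalFugacity (5 / 8) z) /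
    hexParafermionicObservable (Λ δ) (e δ) hexCriticalFugacity (5 / 8) (b δ)

/-- The arrival mass `Z^{e δ}(z) = F_{x_c, 0}(z) ≥ 0` (the spin-`0` observable is a nonnegative real;
we take its norm). -/
def arrivalMass (Λ : ℝ → Finset HexVertex) (e : ℝ → Sym2 HexVertex) (δ : ℝ) (z : Sym2 HexVertex) : ℝ :=
  ‖hexParafermionicObservable (Λ δ) (e δ) hexCriticalFugacity 0 z‖

/-- Bulk test functions of the target: continuous, compactly supported inside the domain. -/
def IsTest (D : DobrushinDomain) (ψ : ℂ → ℂ) : Prop :=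
  Continuous ψ ∧ HasCompactSupport ψ ∧ tsupport ψ ⊆ D.carrier

/-- The root-free part of the target's hypotheses (verbatim `two-root-quotient`): flat piece and
exact half-lattice around the normalisation point `D.pt 1`, eventual admissibility of `Λ δ`,
exhaustion of compacts, `b δ → pt 1`. -/
def AdmissibleFamily (D : DobrushinDomain) (ρ : ℝ) (Λ : ℝ → Finset HexVertex) (m : ℝ → ℤ)
    (b : ℝ → Sym2 HexVertex) : Prop :=
  0 < ρ ∧
  D.carrier ∩ Metric.ball (D.pt 1) ρ = {z : ℂ | (D.pt 1).im < z.im} ∩ Metric.ball (D.pt 1) ρ ∧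
  (∀ᶠ δ : ℝ in 𝓝[>] 0, hexDomainSimplyConnected (Λ δ) ∧ b δ ∈ hexDomainBoundary (Λ δ) ∧
      (hexGraph.induce ((Λ δ : Finset HexVertex) : Set HexVertex)).Preconnected ∧
      (∀ v ∈ Λ δ, (δ : ℂ) * hexCenter v ∈ D.carrier) ∧
      (∀ v : HexVertex, (δ : ℂ) * hexCenter v ∈ Metric.ball (D.pt 1) ρ → (v ∈ Λ δ ↔ m δ ≤ v.1 1))) ∧
  (∀ K : Set ℂ, IsCompact K → K ⊆ D.carrier →
      ∀ᶠ δ : ℝ in 𝓝[>] 0, ∀ v : HexVertex, (δ : ℂ) * hexCenter v ∈ K → v ∈ Λ δ) ∧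
  Tendsto (fun δ : ℝ => (δ : ℂ) * hexMidpoint (b δ)) (𝓝[>] 0) (𝓝 (D.pt 1))

/-- A root family `e` PINNED on a flat piece at `x ∈ ∂D` (verbatim `two-root-quotient`): inside
`ball x r` the domain is the open half-plane above `x` and `Λ δ` is exactly the half-lattice
`{v | mr δ ≤ v.1 1}`; the roots are boundary mid-edges with `δ·mid(e δ) → x`, and walks to the
normaliser exist. -/
def PinnedFlatRoot (D : DobrushinDomain) (Λ : ℝ → Finset HexVertex) (b : ℝ → Sym2 HexVertex)
    (x : ℂ) (e : ℝ → Sym2 HexVertex) (r : ℝ) (mr : ℝ → ℤ) : Prop :=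
  0 < r ∧
  D.carrier ∩ Metric.ball x r = {z : ℂ | x.im < z.im} ∩ Metric.ball x r ∧
  (∀ᶠ δ : ℝ in 𝓝[>] 0, e δ ∈ hexDomainBoundary (Λ δ) ∧ Nonempty (HexMidEdgeSAW (Λ δ) (e δ) (b δ)) ∧
      (∀ v : HexVertex, (δ : ℂ) * hexCenter v ∈ Metric.ball x r → (v ∈ Λ δ ↔ mr δ ≤ v.1 1))) ∧
  Tendsto (fun δ : ℝ => (δ : ℂ) * hexMidpoint (e δ)) (𝓝[>] 0) (𝓝 x)

/-- `g` is the weak limit of the normalised functionals of root family `e` along the mesh sequence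
`ns` (verbatim `two-root-quotient`): `N^{e}_{ns n}(ψ) → ∫ ψ g` for every bulk test function. -/
def IsWeakLimit (D : DobrushinDomain) (Λ : ℝ → Finset HexVertex) (e b : ℝ → Sym2 HexVertex)
    (ns : ℕ → ℝ) (g : ℂ → ℂ) : Prop :=
  ∀ ψ : ℂ → ℂ, IsTest D ψ → Tendsto (fun n => NF Λ e b (ns n) ψ) atTop (𝓝 (∫ z, ψ z * g z))

/-- The flat boundary points seen by a root pinned at `x` (radius `r`) (verbatim
`two-root-quotient`): the normaliser's flat piece `I` and the root's own flat piece. -/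
def flatPoints (D : DobrushinDomain) (ρ : ℝ) (x : ℂ) (r : ℝ) : Set ℂ :=
  ({z : ℂ | z.im = (D.pt 1).im} ∩ Metric.ball (D.pt 1) ρ) ∪ ({z : ℂ | z.im = x.im} ∩ Metric.ball x r)

/-- Root regularity of a limit density `g` of a root pinned at `x` (verbatim `two-root-quotient`'s
`IsCupLimit`): holomorphic and zero-free on the domain, blow-up of exact order `5/4` at its own
root, and non-zero boundary values at every other flat boundary point. -/
def IsCupLimit (D : DobrushinDomain) (ρ : ℝ) (x : ℂ) (r : ℝ) (g : ℂ → ℂ) : Prop :=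
  DifferentiableOn ℂ g D.carrier ∧ (∀ z ∈ D.carrier, g z ≠ 0) ∧
  (∃ κ : ℂ, κ ≠ 0 ∧ Tendsto (fun z => g z * (z - x) ^ ((5 : ℂ) / 4)) (𝓝[D.carrier] x) (𝓝 κ)) ∧
  (∀ y ∈ flatPoints D ρ x r, y ≠ x → ∃ w : ℂ, w ≠ 0 ∧ Tendsto g (𝓝[D.carrier] y) (𝓝 w))

/-- The Wirtinger derivative `∂̄G = (∂_x G + i ∂_y G)/2` of a real-differentiable `G : ℂ → ℂ`. -/
def dbar (G : ℂ → ℂ) (z : ℂ) : ℂ :=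
  (fderiv ℝ G z 1 + Complex.I * fderiv ℝ G z Complex.I) / 2

/-- The POSITIVE BOUNDARY ARRIVAL FUNCTIONAL `⟨λ^{e}_δ, H⟩ := δ Σ_{v ∈ Λ_δ} Σ_{t ∼ v, t ∉ Λ_δ}
H(δ·mid{v,t}) · Z^{e}_δ({v,t}) / Z^{e}_δ(b_δ)` — the boundary arrival masses of the `e δ`-rooted
critical walks, normalised at `b δ`, as a discrete measure on the scaled boundary mid-edges (the
support of `H` localises it; on a rigid gate it is the line's measure `λ_δ`). -/
def arrivalFunctional (Λ : ℝ → Finset HexVertex) (e b : ℝ → Sym2 HexVertex) (δ : ℝ)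
    (H : ℂ → ℂ) : ℂ :=
  (δ : ℂ) * ∑ v ∈ Λ δ, ∑ᶠ t ∈ {t : HexVertex | hexGraph.Adj v t ∧ t ∉ Λ δ},
    H ((δ : ℂ) * hexMidpoint s(v, t)) * ((arrivalMass Λ e δ s(v, t) / arrivalMass Λ e δ (b δ) : ℝ) : ℂ)

/-- The EXACT LATTICE PHASE of `F^{x}_δ(e)/F^{x}_δ(b_δ)` at a gate boundary mid-edge with scaled
position `z` (discrete Umlaufsatz / boundary winding rigidity; consistent with the audited continuum
branch, Disproof (F5)): on the flat line through both pinned points (when the root `x` lies on the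
normaliser's line and the two gates overlap or touch) the phase is `1` on `pt 1`'s side of `x` and
flips by `e^{−5πi/4}` (left of `x`, `b` right) resp. `e^{+5πi/4}` (right of `x`, `b` left);
otherwise it is `1` on the whole normaliser gate and `u₀` (right of `x`) / `u₀ e^{−5πi/4}` (left of
`x`) on the root gate, `u₀` a unit depending on the carrier only (`e^{i(5/8)·2πk}`, `2πk` the net
tangent rotation of the boundary arc from the root to `b`). -/
def gatePhase (D : DobrushinDomain) (ρ r : ℝ) (x u₀ z : ℂ) : ℂ :=
  if x.im = (D.pt 1).im ∧ |x.re - (D.pt 1).re| < ρ + r then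
    (if (z.re < x.re ↔ (D.pt 1).re < x.re) then 1
      else (if z.re < x.re then Complex.exp (-(5 / 4 : ℂ) * Real.pi * Complex.I)
        else Complex.exp ((5 / 4 : ℂ) * Real.pi * Complex.I)))
  else
    (if z ∈ Metric.ball (D.pt 1) ρ then 1
      else (if x.re < z.re then u₀ else u₀ * Complex.exp (-(5 / 4 : ℂ) * Real.pi * Complex.I)))

/-- The two gates with margins, punctured at the root: `(ball (pt 1) ρ' ∪ ball x r') ∖ ball x r₁`. -/
def gateSet (D : DobrushinDomain) (ρ' : ℝ) (x : ℂ) (r' r₁ : ℝ) : Set ℂ :=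
  (Metric.ball (D.pt 1) ρ' ∪ Metric.ball x r') \ Metric.ball x r₁

/-- The lattice depth of a vertex: the distance from `c_v` to the nearest centre of a vertex NOT in
`Λ` (so `v` is `R`-deep in the sense of `DefectDecoherence` for every `R < hexDepth Λ v`). -/
def hexDepth (Λ : Finset HexVertex) (v : HexVertex) : ℝ :=
  sInf ((fun y : HexVertex => dist (hexCenter y) (hexCenter v)) '' ((↑Λ : Set HexVertex)ᶜ))

/-- The star mass `M_v := Σ_{t ∼ v} Z_δ({v,t})` of a vertex (all three neighbours, boundary edges
included). -/
def starMass (Λ : ℝ → Finset HexVertex) (e : ℝ → Sym2 HexVertex) (δ : ℝ) (v : HexVertex) : ℝ :=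
  ∑ᶠ t ∈ {t : HexVertex | hexGraph.Adj v t}, arrivalMass Λ e δ s(v, t)

/-! ### 2. The statements of the line

All statements quantify over an admissible family (`AdmissibleFamily`, normaliser `b` pinned at
`pt 1`) and a pinned flat root `x ≠ pt 1` (`PinnedFlatRoot`; the frame root at `pt 0` AND the
auxiliary roots on the flat piece `I ∋ b` that the two-root closing uses), and — where they speak
about the gates — over margins `ρ' < ρ`, `r' < r` and a puncture radius `r₁ > 0` at the root, so
that every sum lives strictly inside the exact half-lattice balls. -/

/-- OUTPUT OF STUB 1 — the asymptotic GATE IDENTITIES of the critical observable rooted at a pinned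
flat root `x ≠ pt 1`, normalised at `b δ`:
(h) WEAK HOLOMORPHY in the bulk: `N_δ(∂̄G) → 0` for `G ∈ C²_c(Ω)` (the identity with zero boundary
side: curl pairing by `DefectDecoherence` at depth `d/δ` + `MassRatio`, Taylor junk by `MassRatio`);
(g) the GATE IDENTITY: there is a unit `u₀` such that for every `G ∈ C²_c` supported in the two
open gate balls and vanishing near the root,
`(−i/(2√3))·⟨λ_δ, gatePhase·G⟩ − (1/6)·N_δ(∂̄G) → 0`
(exact Cauchy–Pompeiu identity; boundary side = gate edges only, each `(mid − c_v)F(e)/F(b) =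
(−iℓ/2)·phase·Z(e)/Z(b)` by winding rigidity; interior side `(ℓ²/2)N_δ(∂̄G)` plus the curl pairing
`δ²Σ|∂G||T|/Z(b)` — bulk part `O(η^{−θ}δ^{θ−3/4})` by DD + MR, gate-collar part `≤ ε` by
`GateCollarBudget` with `|T(v)| ≤ C min(1, depth^{−θ}) M_v` — plus Taylor junk `O(δ³Σ|∇²G|Z/Z(b))`
by `GateTotalMass` and the one-star boundary correction `O(δ)·⟨λ_δ,|∂̄G|⟩` by `GateTightness`). -/
def GateSumRules : Prop :=
  ∀ (D : DobrushinDomain) (ρ : ℝ) (Λ : ℝ → Finset HexVertex) (m : ℝ → ℤ) (b : ℝ → Sym2 HexVertex),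
    AdmissibleFamily D ρ Λ m b →
  ∀ (x : ℂ) (e : ℝ → Sym2 HexVertex) (r : ℝ) (mr : ℝ → ℤ), PinnedFlatRoot D Λ b x e r mr → x ≠ D.pt 1 →
    (∀ G : ℂ → ℂ, ContDiff ℝ 2 G → HasCompactSupport G → tsupport G ⊆ D.carrier →
        Tendsto (fun δ : ℝ => NF Λ e b δ (dbar G)) (𝓝[>] 0) (𝓝 0)) ∧
    ∃ u₀ : ℂ, ‖u₀‖ = 1 ∧
      ∀ G : ℂ → ℂ, ContDiff ℝ 2 G → HasCompactSupport G →
        tsupport G ⊆ Metric.ball (D.pt 1) ρ ∪ Metric.ball x r →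
        (∃ r₁ : ℝ, 0 < r₁ ∧ ∀ z ∈ Metric.ball x r₁, G z = 0) →
        Tendsto (fun δ : ℝ =>
            (-Complex.I / (2 * Real.sqrt 3)) *
                arrivalFunctional Λ e b δ (fun z => gatePhase D ρ r x u₀ z * G z) -
              (1 / 6 : ℂ) * NF Λ e b δ (dbar G))
          (𝓝[>] 0) (𝓝 0)

/-- POSITIVE-MASS INPUT (i) — the GATE COLLAR BUDGET in the summed form the bookkeeping consumes:
for every `θ > 3/4` the depth-discounted star masses of the `η/δ`-collar ABOVE THE TWO FLAT GATES
(punctured at the root) are `≤ ε·Z_δ(b_δ)/δ²` eventually, for `η` small.  (Dimensional check: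
layer `r` carries `(L/δ)` vertices of mass `Z(b)·r^{25/48}`, so the sum is
`δ Σ_{r ≤ η/δ} r^{25/48−θ} = O(η^{73/48−θ}δ^{θ−25/48} + δ) → 0`; only the EXACT flat gates are
involved, so it is plausible for every carrier and every admissible collar.) -/
def GateCollarBudget : Prop :=
  ∀ (D : DobrushinDomain) (ρ : ℝ) (Λ : ℝ → Finset HexVertex) (m : ℝ → ℤ) (b : ℝ → Sym2 HexVertex),
    AdmissibleFamily D ρ Λ m b →
  ∀ (x : ℂ) (e : ℝ → Sym2 HexVertex) (r : ℝ) (mr : ℝ → ℤ), PinnedFlatRoot D Λ b x e r mr → x ≠ D.pt 1 →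
  ∀ ρ' r' r₁ : ℝ, ρ' < ρ → r' < r → 0 < r₁ →
  ∀ θ : ℝ, 3 / 4 < θ → ∀ ε : ℝ, 0 < ε → ∃ η : ℝ, 0 < η ∧ ∀ᶠ δ : ℝ in 𝓝[>] 0,
    δ ^ 2 * ∑ v ∈ (Λ δ).filter (fun v =>
        (δ : ℂ) * hexCenter v ∈ gateSet D ρ' x r' r₁ ∧ hexDepth (Λ δ) v ≤ η / δ),
        min 1 (hexDepth (Λ δ) v ^ (-θ)) * starMass Λ e δ v ≤
      ε * arrivalMass Λ e δ (b δ)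

/-- POSITIVE-MASS INPUT (ii) — GATE TOTAL MASS: `δ³ Σ_{z over the gates, off the root} Z_δ(z) =
o(Z_δ(b_δ))` (controls the second-order Taylor junk of the gate identity; predicted `δ^{23/48}`). -/
def GateTotalMass : Prop :=
  ∀ (D : DobrushinDomain) (ρ : ℝ) (Λ : ℝ → Finset HexVertex) (m : ℝ → ℤ) (b : ℝ → Sym2 HexVertex),
    AdmissibleFamily D ρ Λ m b →
  ∀ (x : ℂ) (e : ℝ → Sym2 HexVertex) (r : ℝ) (mr : ℝ → ℤ), PinnedFlatRoot D Λ b x e r mr → x ≠ D.pt 1 →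
  ∀ ρ' r' r₁ : ℝ, ρ' < ρ → r' < r → 0 < r₁ →
    Tendsto (fun δ : ℝ => δ ^ 3 *
        (∑ᶠ z ∈ {z : Sym2 HexVertex | z ∈ hexDomainMidEdges (Λ δ) ∧
            (δ : ℂ) * hexMidpoint z ∈ gateSet D ρ' x r' r₁}, arrivalMass Λ e δ z) /
          arrivalMass Λ e δ (b δ))
      (𝓝[>] 0) (𝓝 0)

/-- POSITIVE-MASS INPUT (iii) — GATE TIGHTNESS: the boundary arrival masses ON THE TWO FLAT GATES
(punctured at the root) total `O(Z_δ(b_δ)/δ)`, i.e. the positive gate measures `λ_δ` have bounded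
mass.  (Predicted density `|Φ'(y)/Φ'(b)|^{5/8}`, bounded on compact sub-gates, `|y − x|^{−5/4}` near
the root — integrable away from it; at the end of a flat piece at worst `|y − p|^{−5/16}`.  The
GLOBAL analogue (gen 1) fails for wild carriers; this one involves the exact gates only.) -/
def GateTightness : Prop :=
  ∀ (D : DobrushinDomain) (ρ : ℝ) (Λ : ℝ → Finset HexVertex) (m : ℝ → ℤ) (b : ℝ → Sym2 HexVertex),
    AdmissibleFamily D ρ Λ m b →
  ∀ (x : ℂ) (e : ℝ → Sym2 HexVertex) (r : ℝ) (mr : ℝ → ℤ), PinnedFlatRoot D Λ b x e r mr → x ≠ D.pt 1 →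
  ∀ ρ' r' r₁ : ℝ, ρ' < ρ → r' < r → 0 < r₁ → ∃ C : ℝ, ∀ᶠ δ : ℝ in 𝓝[>] 0,
    δ * ∑ v ∈ Λ δ, ∑ᶠ t ∈ {t : HexVertex | hexGraph.Adj v t ∧ t ∉ Λ δ ∧
        (δ : ℂ) * hexMidpoint s(v, t) ∈ gateSet D ρ' x r' r₁}, arrivalMass Λ e δ s(v, t) ≤
      C * arrivalMass Λ e δ (b δ)

/-- The positive-mass package of the line (stub 2): three UPPER bounds on positive, domain-monotone
arrival masses, Φ-free, involving only the exact gates — decidable size by size (exact enumeration,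
transfer matrices). -/
def PositiveMassLaws : Prop :=
  GateCollarBudget ∧ GateTotalMass ∧ GateTightness

/-- The local `L¹` bound (VERBATIM the `LocalL1Bound` of `Lines/pick-half-plane` and of gen 1): for every
admissible family and every pinned flat root `x ≠ pt 1`, on every compact `K ⊂ Ω`,
`δ² Σ_{z : δ·mid z ∈ K} |F_δ(z)| ≤ C_K |F_δ(b_δ)|` eventually.  NECESSARY for the target by
Banach–Steinhaus; its curl part is free from `DefectDecoherence` + `MassRatio`, the un-mollified
signal part is the "exponent-sharp Harnack" content (the crux's failure mode (i)). -/
def LocalL1Bound : Prop :=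
  ∀ (D : DobrushinDomain) (ρ : ℝ) (Λ : ℝ → Finset HexVertex) (m : ℝ → ℤ) (b : ℝ → Sym2 HexVertex),
    AdmissibleFamily D ρ Λ m b →
  ∀ (x : ℂ) (e : ℝ → Sym2 HexVertex) (r : ℝ) (mr : ℝ → ℤ), PinnedFlatRoot D Λ b x e r mr → x ≠ D.pt 1 →
  ∀ K : Set ℂ, IsCompact K → K ⊆ D.carrier → ∃ C : ℝ, ∀ᶠ δ : ℝ in 𝓝[>] 0,
    δ ^ 2 * (∑ᶠ z ∈ {z : Sym2 HexVertex | z ∈ hexDomainMidEdges (Λ δ) ∧ (δ : ℂ) * hexMidpoint z ∈ K},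
        ‖hexParafermionicObservable (Λ δ) (e δ) hexCriticalFugacity (5 / 8) z‖) ≤
      C * ‖hexParafermionicObservable (Λ δ) (e δ) hexCriticalFugacity (5 / 8) (b δ)‖

/-- The GATE `L¹` BOUND — the same eventual bound for compacts reaching the flat boundary INSIDE the
two exact gate balls (margins `ρ' < ρ`, `r' < r`; the root included: `|z − x|^{−5/4} ∈ L¹(dA)`).
BOUNDEDNESS ONLY — no "no-concentration" and no pointwise boundary-layer statement is asked: the
test functions `g̃` of stub 4 make the thin gate layer invisible. -/
def GateL1Bound : Prop :=
  ∀ (D : DobrushinDomain) (ρ : ℝ) (Λ : ℝ → Finset HexVertex) (m : ℝ → ℤ) (b : ℝ → Sym2 HexVertex),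
    AdmissibleFamily D ρ Λ m b →
  ∀ (x : ℂ) (e : ℝ → Sym2 HexVertex) (r : ℝ) (mr : ℝ → ℤ), PinnedFlatRoot D Λ b x e r mr → x ≠ D.pt 1 →
  ∀ ρ' r' : ℝ, ρ' < ρ → r' < r → ∃ C : ℝ, ∀ᶠ δ : ℝ in 𝓝[>] 0,
    δ ^ 2 * (∑ᶠ z ∈ {z : Sym2 HexVertex | z ∈ hexDomainMidEdges (Λ δ) ∧
        (δ : ℂ) * hexMidpoint z ∈ Metric.ball (D.pt 1) ρ' ∪ Metric.ball x r'},
        ‖hexParafermionicObservable (Λ δ) (e δ) hexCriticalFugacity (5 / 8) z‖) ≤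
      C * ‖hexParafermionicObservable (Λ δ) (e δ) hexCriticalFugacity (5 / 8) (b δ)‖

/-- The `L¹` control of the line (stub 3): the interior bound on compacts and its gate version. -/
def L1Control : Prop :=
  LocalL1Bound ∧ GateL1Bound

/-- Two-root boundary Harnack principle (verbatim `two-root-quotient`'s `RatioContinuity`): near every
boundary point `p` other than the two pinned flat roots, on every locally connected piece `S` of
`Λ δ` inside the ball, the observables from the two roots are asymptotically PROPORTIONAL as
functions of the target mid-edge (division-free determinant form; the Kennedy–Lawler class factor
of a boundary target cancels because the target is the same for both roots; local connectivity
excludes the far-attached dead-end corridor). -/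
def RatioContinuity : Prop :=
  ∀ (D : DobrushinDomain) (ρ : ℝ) (Λ : ℝ → Finset HexVertex) (m : ℝ → ℤ) (b : ℝ → Sym2 HexVertex),
    AdmissibleFamily D ρ Λ m b →
  ∀ (x : ℂ) (e : ℝ → Sym2 HexVertex) (r : ℝ) (mr : ℝ → ℤ)
    (x' : ℂ) (e' : ℝ → Sym2 HexVertex) (r' : ℝ) (mr' : ℝ → ℤ),
    PinnedFlatRoot D Λ b x e r mr → PinnedFlatRoot D Λ b x' e' r' mr' → x ≠ x' →
  ∀ p ∈ frontier D.carrier, p ≠ x → p ≠ x' →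
  ∀ ε : ℝ, 0 < ε → ∃ s : ℝ, 0 < s ∧ ∀ᶠ δ : ℝ in 𝓝[>] 0,
    ∀ S : Finset HexVertex, S ⊆ Λ δ → (∀ v ∈ S, (δ : ℂ) * hexCenter v ∈ Metric.ball p s) →
      (hexGraph.induce ((S : Finset HexVertex) : Set HexVertex)).Preconnected →
    ∀ z ∈ hexDomainMidEdges (Λ δ), ∀ z' ∈ hexDomainMidEdges (Λ δ),
      (∃ v ∈ z, v ∈ S) → (∃ v ∈ z', v ∈ S) →
      ‖hexParafermionicObservable (Λ δ) (e δ) hexCriticalFugacity (5 / 8) z *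
            hexParafermionicObservable (Λ δ) (e' δ) hexCriticalFugacity (5 / 8) z' -
          hexParafermionicObservable (Λ δ) (e δ) hexCriticalFugacity (5 / 8) z' *
            hexParafermionicObservable (Λ δ) (e' δ) hexCriticalFugacity (5 / 8) z‖ ≤
        ε * (‖hexParafermionicObservable (Λ δ) (e δ) hexCriticalFugacity (5 / 8) z‖ *
              ‖hexParafermionicObservable (Λ δ) (e' δ) hexCriticalFugacity (5 / 8) z'‖ +
            ‖hexParafermionicObservable (Λ δ) (e δ) hexCriticalFugacity (5 / 8) z'‖ *
              ‖hexParafermionicObservable (Λ δ) (e' δ) hexCriticalFugacity (5 / 8) z‖)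

/-- One-root FLAT RATIO CONTINUITY on the gates (the qualitative, rate-free form of
birkhoff-crosscut-contraction's `FlatBoundaryRatioMixing`, down to the lattice scale): the arrival
masses of ONE pinned root at two gate boundary mid-edges (off the root) closer than `s(ε)` agree
within a factor `1 ± ε`, eventually.  Equicontinuity of the log-arrival profile along the exact
flat gates: it upgrades the weak limit of `λ_δ` to locally uniform convergence of densities, gives
`λ' > 0`, and at `b` itself the density `1` per unit length (hence the universal `K = 2√3`). -/
def FlatRatioContinuity : Prop :=
  ∀ (D : DobrushinDomain) (ρ : ℝ) (Λ : ℝ → Finset HexVertex) (m : ℝ → ℤ) (b : ℝ → Sym2 HexVertex),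
    AdmissibleFamily D ρ Λ m b →
  ∀ (x : ℂ) (e : ℝ → Sym2 HexVertex) (r : ℝ) (mr : ℝ → ℤ), PinnedFlatRoot D Λ b x e r mr → x ≠ D.pt 1 →
  ∀ ρ' r' r₁ : ℝ, ρ' < ρ → r' < r → 0 < r₁ →
  ∀ ε : ℝ, 0 < ε → ∃ s : ℝ, 0 < s ∧ ∀ᶠ δ : ℝ in 𝓝[>] 0,
    ∀ v₁ t₁ v₂ t₂ : HexVertex, v₁ ∈ Λ δ → t₁ ∉ Λ δ → hexGraph.Adj v₁ t₁ →
      v₂ ∈ Λ δ → t₂ ∉ Λ δ → hexGraph.Adj v₂ t₂ →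
      (δ : ℂ) * hexMidpoint s(v₁, t₁) ∈ gateSet D ρ' x r' r₁ →
      (δ : ℂ) * hexMidpoint s(v₂, t₂) ∈ gateSet D ρ' x r' r₁ →
      ‖(δ : ℂ) * hexMidpoint s(v₁, t₁) - (δ : ℂ) * hexMidpoint s(v₂, t₂)‖ < s →
      |arrivalMass Λ e δ s(v₁, t₁) - arrivalMass Λ e δ s(v₂, t₂)| ≤ ε * arrivalMass Λ e δ s(v₂, t₂)

/-- Flat-root locality (verbatim `two-root-quotient`'s `FlatLocality`): two pinned flat roots see the
same exact half-lattice, so along a common mesh sequence their blow-up constants agree up to the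
normalisations, `‖κ‖ = μ ‖κ'‖` with `μ = lim Z_{x'}(b_δ)/Z_x(b_δ)`. -/
def FlatLocality : Prop :=
  ∀ (D : DobrushinDomain) (ρ : ℝ) (Λ : ℝ → Finset HexVertex) (m : ℝ → ℤ) (b : ℝ → Sym2 HexVertex),
    AdmissibleFamily D ρ Λ m b →
  ∀ (x : ℂ) (e : ℝ → Sym2 HexVertex) (r : ℝ) (mr : ℝ → ℤ)
    (x' : ℂ) (e' : ℝ → Sym2 HexVertex) (r' : ℝ) (mr' : ℝ → ℤ),
    PinnedFlatRoot D Λ b x e r mr → PinnedFlatRoot D Λ b x' e' r' mr' → x ≠ D.pt 1 → x' ≠ D.pt 1 →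
  ∀ ns : ℕ → ℝ, Tendsto ns atTop (𝓝[>] 0) →
  ∀ (g g' : ℂ → ℂ) (κ κ' : ℂ) (μ : ℝ),
    IsWeakLimit D Λ e b ns g → IsWeakLimit D Λ e' b ns g' →
    Tendsto (fun z => g z * (z - x) ^ ((5 : ℂ) / 4)) (𝓝[D.carrier] x) (𝓝 κ) →
    Tendsto (fun z => g' z * (z - x') ^ ((5 : ℂ) / 4)) (𝓝[D.carrier] x') (𝓝 κ') →
    Tendsto (fun n => arrivalMass Λ e' (ns n) (b (ns n)) / arrivalMass Λ e (ns n) (b (ns n)))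
      atTop (𝓝 μ) →
    ‖κ‖ = μ * ‖κ'‖

/-- The ratio laws of the line (stub 6): two-root `RatioContinuity`, one-root `FlatRatioContinuity`
on the gates, `FlatLocality` — two-sided statements about POSITIVE arrival masses (mixing /
locality), Φ-free. -/
def RatioLaws : Prop :=
  RatioContinuity ∧ FlatRatioContinuity ∧ FlatLocality

/-- LOWER BOUND (i) — near-root arrivals: every boundary mid-edge of the root's gate within `r₁` of
the root receives at least `c·Z_δ(b_δ)` (predicted `Z_δ(e)/Z_δ(b_δ) ≍ |δe − x|^{−5/4} → ∞`; this is
what makes the order at the root EXACTLY `5/4`: positivity leaves `5/4 − 2j`, the lower bound kills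
`j ≥ 1`). -/
def RootGateLowerBound : Prop :=
  ∀ (D : DobrushinDomain) (ρ : ℝ) (Λ : ℝ → Finset HexVertex) (m : ℝ → ℤ) (b : ℝ → Sym2 HexVertex),
    AdmissibleFamily D ρ Λ m b →
  ∀ (x : ℂ) (e : ℝ → Sym2 HexVertex) (r : ℝ) (mr : ℝ → ℤ), PinnedFlatRoot D Λ b x e r mr → x ≠ D.pt 1 →
  ∃ c : ℝ, 0 < c ∧ ∃ r₁ : ℝ, 0 < r₁ ∧ ∀ᶠ δ : ℝ in 𝓝[>] 0,
    ∀ v t : HexVertex, v ∈ Λ δ → t ∉ Λ δ → hexGraph.Adj v t →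
      (δ : ℂ) * hexMidpoint s(v, t) ∈ Metric.ball x r₁ →
      c * arrivalMass Λ e δ (b δ) ≤ arrivalMass Λ e δ s(v, t)

/-- LOWER BOUND (ii) — zero-freeness of the holomorphic weak limits in the bulk (conjecturally
`g = c (Φ_x'/Φ_x'(b))^{5/8}` with `Φ_x' ≠ 0`; engines: Hurwitz from univalence in measure of the
developing map (three-eighths-cup-harnack), Pick positivity on convex carriers (pick-half-plane);
the gate traces of this line do not see the bulk). -/
def BulkZeroFree : Prop :=
  ∀ (D : DobrushinDomain) (ρ : ℝ) (Λ : ℝ → Finset HexVertex) (m : ℝ → ℤ) (b : ℝ → Sym2 HexVertex),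
    AdmissibleFamily D ρ Λ m b →
  ∀ (x : ℂ) (e : ℝ → Sym2 HexVertex) (r : ℝ) (mr : ℝ → ℤ), PinnedFlatRoot D Λ b x e r mr → x ≠ D.pt 1 →
  ∀ ns : ℕ → ℝ, Tendsto ns atTop (𝓝[>] 0) →
  ∀ g : ℂ → ℂ, DifferentiableOn ℂ g D.carrier → IsWeakLimit D Λ e b ns g → ∀ z ∈ D.carrier, g z ≠ 0

/-- The lower bounds of the line (stub 5, HARDEST): near-root arrival lower bound and bulk
zero-freeness — the only statements of the line that bound anything from BELOW. -/
def LowerBounds : Prop :=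
  RootGateLowerBound ∧ BulkZeroFree

/-- Cup limits along subsequences (verbatim `two-root-quotient`'s `CupLimits`): for every admissible
family and every pinned flat root other than the normalisation point, every mesh sequence has a
subsequence along which the normalised functionals converge weakly to a cup limit (holomorphic,
zero-free, order-`5/4` blow-up at the root, non-zero boundary values at the other flat points). -/
def CupLimits : Prop :=
  ∀ (D : DobrushinDomain) (ρ : ℝ) (Λ : ℝ → Finset HexVertex) (m : ℝ → ℤ) (b : ℝ → Sym2 HexVertex),
    AdmissibleFamily D ρ Λ m b →
  ∀ (x : ℂ) (e : ℝ → Sym2 HexVertex) (r : ℝ) (mr : ℝ → ℤ),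
    PinnedFlatRoot D Λ b x e r mr → x ≠ D.pt 1 →
  ∀ ns : ℕ → ℝ, Tendsto ns atTop (𝓝[>] 0) →
    ∃ ms : ℕ → ℕ, StrictMono ms ∧ ∃ g : ℂ → ℂ, IsCupLimit D ρ x r g ∧ IsWeakLimit D Λ e b (ns ∘ ms) g

/-- Flat trace with ONE universal boundary-layer constant `K ≠ 0` (verbatim `two-root-quotient`'s
`FlatTrace`; here an OUTPUT of stub 4 with `K = 2√3`): for a cup limit `g` of a pinned flat root
`x ≠ pt 1`, (i) its boundary value at the normalisation point is `K`; (ii) at every point `y ≠ x` of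
the flat piece `I` around `pt 1`, approached by boundary mid-edges `ey δ`, the arrival-mass ratios
`Z_x(ey_δ)/Z_x(b_δ)` converge to `‖w‖/‖K‖`, `w` the boundary value of `g` at `y`; (iii) if the root's
ball misses the normaliser's, the phase of `w` is that of `K`. -/
def FlatTrace : Prop :=
  ∃ K : ℂ, K ≠ 0 ∧
  ∀ (D : DobrushinDomain) (ρ : ℝ) (Λ : ℝ → Finset HexVertex) (m : ℝ → ℤ) (b : ℝ → Sym2 HexVertex),
    AdmissibleFamily D ρ Λ m b →
  ∀ (x : ℂ) (e : ℝ → Sym2 HexVertex) (r : ℝ) (mr : ℝ → ℤ), PinnedFlatRoot D Λ b x e r mr → x ≠ D.pt 1 →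
  ∀ ns : ℕ → ℝ, Tendsto ns atTop (𝓝[>] 0) →
  ∀ g : ℂ → ℂ, IsCupLimit D ρ x r g → IsWeakLimit D Λ e b ns g →
    Tendsto g (𝓝[D.carrier] (D.pt 1)) (𝓝 K) ∧
    ∀ (y : ℂ) (ey : ℝ → Sym2 HexVertex) (w : ℂ),
      y.im = (D.pt 1).im → y ∈ Metric.ball (D.pt 1) ρ → y ≠ x →
      (∀ᶠ δ : ℝ in 𝓝[>] 0, ey δ ∈ hexDomainBoundary (Λ δ)) →
      Tendsto (fun δ : ℝ => (δ : ℂ) * hexMidpoint (ey δ)) (𝓝[>] 0) (𝓝 y) →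
      Tendsto g (𝓝[D.carrier] y) (𝓝 w) →
      Tendsto (fun n => arrivalMass Λ e (ns n) (ey (ns n)) / arrivalMass Λ e (ns n) (b (ns n)))
          atTop (𝓝 (‖w‖ / ‖K‖)) ∧
        (Disjoint (Metric.ball x r) (Metric.ball (D.pt 1) ρ) → w = K * ((‖w‖ / ‖K‖ : ℝ) : ℂ))

/-- OUTPUT OF STUB 4 — REGULAR LIMITS: cup limits along subsequences AND the flat trace. -/
def RegularLimits : Prop :=
  CupLimits ∧ FlatTrace

/-- OUTPUT OF STUB 7 — identification of every subsequential cup limit of the TARGET's root with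
ONE universal constant (verbatim `two-root-quotient`'s `Identification`):
`g = c · exp((5/8)(L − L_b))` on the domain. -/
def Identification : Prop :=
  ∃ c : ℂ, c ≠ 0 ∧
  ∀ (D : DobrushinDomain) (ρ : ℝ) (Λ : ℝ → Finset HexVertex) (m : ℝ → ℤ) (b : ℝ → Sym2 HexVertex),
    AdmissibleFamily D ρ Λ m b →
  ∀ (a : ℝ → Sym2 HexVertex) (r₀ : ℝ) (m₀ : ℝ → ℤ), PinnedFlatRoot D Λ b (D.pt 0) a r₀ m₀ →
  ∀ (Φ : ConformalEquiv D.carrier UpperHalfPlane.upperHalfPlaneSet) (L : ℂ → ℂ) (Lb : ℂ),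
    Tendsto (fun z => ‖Φ z‖) (𝓝[D.carrier] (D.pt 0)) atTop → Φ.HasBoundaryValue (D.pt 1) 0 →
    ContinuousOn L D.carrier → (∀ z ∈ D.carrier, Complex.exp (L z) = deriv Φ z) →
    Tendsto L (𝓝[D.carrier] (D.pt 1)) (𝓝 Lb) →
  ∀ ns : ℕ → ℝ, Tendsto ns atTop (𝓝[>] 0) →
  ∀ g : ℂ → ℂ, IsCupLimit D ρ (D.pt 0) r₀ g → IsWeakLimit D Λ a b ns g →
    ∀ z ∈ D.carrier, g z = c * Complex.exp ((5 / 8 : ℂ) * (L z - Lb))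

/-! ### 3. The registered stubs (the only `sorry`s of the file) -/

/-- STUB 1 (L; the lever, lattice side): the asymptotic GATE IDENTITIES at the route's cut.  Proof
plan: the exact discrete Cauchy–Pompeiu identity (`Ideator2gSketch.DiscreteCauchyPompeiu`, from
`DuminilCopinSmirnov2012_lemma1_holds` — prove it first as a `--supports` helper); the exact gate
phases by the discrete Umlaufsatz (`HexSAWWinding`/`HexSAWHopfPath`, cf. support item
BoundaryWindingRigidity stmt-8515): `W_x(e) − W_x(b)` is `0` on `b`'s component of the flat line,
`±2π` across the root (`gatePhase`); the per-vertex expansion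
`(mid − c_v)(G(δ·mid) − G(δc_v)) = δ(ℓ/2)²[e^{3iα_v}(2/ℓ)∂G·T(v)-summand + ∂̄G·S(v)-summand] + O(δ²)`
with `u_t² = e^{3iα_v} ū_t`; bookkeeping: bulk curl pairing by `DefectDecoherence` (vertices of
lattice depth `≥ η/δ` are `(η/2δ)`-deep) and `MassRatio` (re-mark the Dobrushin domain at
`(x, pt 1)` for an auxiliary root), gate collars by `GateCollarBudget`, Taylor junk by
`GateTotalMass`, the one-star correction at gate edges by `GateTightness`; conjunct (h) is the case
of a bulk test function (boundary side eventually `0` by exhaustion). -/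
theorem stub_gateRepresentation :
    DefectDecoherence → MassRatio → PositiveMassLaws → GateSumRules := by
  sorry

/-- STUB 2 (L; open, Φ-free, positive-mass): the three upper bounds on gate arrival masses. -/
theorem stub_positiveMassLaws : PositiveMassLaws := by
  sorry

/-- STUB 3 (L–XL; open, cancellation-type): the local `L¹` bound on compacts and on the gates. -/
theorem stub_l1Control : L1Control := by
  sorry

/-- STUB 4 (L; classical analysis — the GATE TRACE THEOREM): from the gate identities, gate
tightness, the `L¹` control, flat ratio continuity and the lower bounds, every mesh sequence has a
subsequence with a cup limit, and the flat trace holds with `K = 2√3`.  Steps: (a) compactness on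
`C_c(Ω)` from `LocalL1Bound` (Banach–Alaoglu, diagonal), holomorphy of limits from (h) (Weyl);
(b) at each gate, tightness ⇒ `λ_δ ⇀ λ` along a further subsequence; with
`g̃ = Σ_{j≤k}(iy)^j g₀^{(j)}/j!` (`∂̄g̃ = O(y^k)`) the identity (g) gives
`⟨bv f, g₀⟩ = 2√3·phase·∫ g₀ dλ` (thin layer `≤ M η^k` by `GateL1Bound`, upper part by weak
convergence; `f ∈ L¹` up to the gate ⇒ `|f| ≤ C y^{−2}` ⇒ distributional boundary values exist);
(c) reflection: `F := ū f` above the gate, `conj F(conj z)` below, has zero distributional jump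
(the boundary distribution `2√3 λ` is REAL), so `∂̄F = 0` in `D'` of a disc on the gate (the two
one-sided boundary terms cancel) and Weyl's lemma makes `F` holomorphic across — `f` continues across
the open gate with `f = 2√3·phase·λ'`, `λ` a.c. with real-analytic density (local F. and M. Riesz,
Mashreghi 2009 Thm 5.10, is the alternative route); `FlatRatioContinuity` ⇒ densities converge
locally uniformly, `λ' > 0`, `λ'(pt 1) = 1`; (d) root gate: with the branch of `(z − x)^{5/4}` cut
along the downward ray, `q := (z − x)^{5/4} ū₀ f` is real `≥ 0` on both sides (flip `e^{−5πi/4}`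
against the branch value `e^{+5πi/4}`), reflects to the punctured disc, `L¹` ⇒ at most a simple
pole, positivity on both sides ⇒ none, so `f(z)(z − x)^{5/4} → κ`; `RootGateLowerBound` ⇒ `κ ≠ 0`
(`q(x) = 0` would force `q = O(|t − x|²)` on the diameter against `q ≥ 2√3 c |t − x|^{5/4}`);
(e) `BulkZeroFree` supplies the remaining clause of `IsCupLimit`; `FlatTrace` (i)–(iii) read off (c). -/
theorem stub_gateTrace :
    GateSumRules → GateTightness → L1Control → FlatRatioContinuity → LowerBounds → RegularLimits := by
  sorry

/-- STUB 5 (XL; open — HARDEST): the lower bounds — near-root arrivals `≥ c Z_δ(b_δ)` and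
zero-freeness of the holomorphic weak limits (suppliers: the cup engine / Pick positivity / a
direct positive-mass argument for (i)). -/
theorem stub_lowerBounds : DefectDecoherence → MassRatio → LowerBounds := by
  sorry

/-- STUB 6 (L; open): the ratio laws — two-root `RatioContinuity`, flat one-root ratio continuity on
the gates, flat-root locality (engine for the first two: crosscut renewal / ratio mixing of positive
kernels; the third is decoherence-type). -/
theorem stub_ratioLaws : RatioLaws := by
  sorry

/-- STUB 7 (L; classical analysis given stubs 4–6 — the two-root closing, audited Disproof (F5)):
two-root arc constancy (exact Umlaufsatz lemma = `two-root-quotient`'s `TwoRootArcConstancy`, prove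
as a helper) + `RatioContinuity` + cup regularity at both roots ⇒ the quotient
`E := g_y (1 − Φ/t_y)^{5/4} / g_a` of the limits of the target root `a` and an auxiliary root `y ∈ I`
has constant argument on `∂Ω ∖ {a, y}` and two-sided bounds ⇒ ROOT-RATIO LAW
`g_y = (1 − Φ/t_y)^{−5/4} g_a` (`= 1` at `b` by `FlatTrace` (i)); covariance of blow-ups +
`FlatLocality` + exact RECIPROCITY `Z_x(y_δ) = Z_y(x_δ)` + `FlatTrace` (ii)/(iii) ⇒
`‖g_a‖ = |K| |Φ'/Φ'(b)|^{5/8}` with constant phase on `I` ⇒ Schwarz reflection + identity theorem ⇒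
`g_a = K exp((5/8)(L − L_b))`, `c := K = 2√3`. -/
theorem stub_closing : RegularLimits → RatioLaws → Identification := by
  sorry

/-! ### Name-keyed aliases of the seven stub statements (hypotheses of the composition)

`Registered.stub_X` is the statement of `stub_X` under the registered stub's short name, so that the
native skeleton audit (`#h21_check_skeleton`: hypotheses admissible iff registered obligations /
declared stubs BY NAME) accepts `BoundaryClosureR_of : Registered.stub_… → … → BoundaryClosureR`. -/
namespace Registered

/-- Alias keyed by the registered stub name. -/
abbrev stub_gateRepresentation : Prop :=
  DefectDecoherence → MassRatio → PositiveMassLaws → GateSumRules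
/-- Alias keyed by the registered stub name. -/
abbrev stub_positiveMassLaws : Prop := PositiveMassLaws
/-- Alias keyed by the registered stub name. -/
abbrev stub_l1Control : Prop := L1Control
/-- Alias keyed by the registered stub name. -/
abbrev stub_gateTrace : Prop :=
  GateSumRules → GateTightness → L1Control → FlatRatioContinuity → LowerBounds → RegularLimits
/-- Alias keyed by the registered stub name. -/
abbrev stub_lowerBounds : Prop := DefectDecoherence → MassRatio → LowerBounds
/-- Alias keyed by the registered stub name. -/
abbrev stub_ratioLaws : Prop := RatioLaws
/-- Alias keyed by the registered stub name. -/
abbrev stub_closing : Prop := RegularLimits → RatioLaws → Identification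

end Registered

/-! ### 4. The sorry-free part: subsequence principle and the composition -/

/-- **Closing step (no `sorry`)** (verbatim `two-root-quotient`): cup limits along subsequences of
every mesh sequence (`CupLimits`) and their identification with one universal constant
(`Identification`) give the pinned target, by `Filter.tendsto_of_subseq_tendsto` on the countably
generated filter `𝓝[>] 0`. -/
theorem closing (hC : CupLimits) (hI : Identification) : HexObservableLimitR := by
  obtain ⟨c, hc, hId⟩ := hI
  refine ⟨c, hc, ?_⟩
  intro D ρ Λ m a b Φ L Lb ψ F hρ hflat hadm hexh ha hb hΦ hΦb hL hexpL hLb hψc hψK hψD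
  -- repackage the hypotheses
  have hAF : AdmissibleFamily D ρ Λ (m 1) b := by
    refine ⟨hρ, hflat 1, ?_, hexh, hb⟩
    filter_upwards [hadm] with δ hδ
    exact ⟨hδ.1, hδ.2.2.1, hδ.2.2.2.2.1, hδ.2.2.2.2.2.1, hδ.2.2.2.2.2.2 1⟩
  have hPR : PinnedFlatRoot D Λ b (D.pt 0) a ρ (m 0) := by
    refine ⟨hρ, hflat 0, ?_, ha⟩
    filter_upwards [hadm] with δ hδ
    exact ⟨hδ.2.1, hδ.2.2.2.1, hδ.2.2.2.2.2.2 0⟩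
  have h01 : D.pt 0 ≠ D.pt 1 := fun h => absurd (D.pt_injective h) (by decide)
  have hψ : IsTest D ψ := ⟨hψc, hψK, hψD⟩
  -- the subsequence principle on the countably generated filter `𝓝[>] 0`
  refine Filter.tendsto_of_subseq_tendsto fun ns hns => ?_
  obtain ⟨ms, hms, g, hg, hw⟩ := hC D ρ Λ (m 1) b hAF (D.pt 0) a ρ (m 0) hPR h01 ns hns
  have hns' : Tendsto (ns ∘ ms) atTop (𝓝[>] 0) := hns.comp hms.tendsto_atTop
  have hid : ∀ z ∈ D.carrier, g z = c * Complex.exp ((5 / 8 : ℂ) * (L z - Lb)) :=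
    hId D ρ Λ (m 1) b hAF a ρ (m 0) hPR Φ L Lb hΦ hΦb hL hexpL hLb (ns ∘ ms) hns' g hg hw
  -- the limit density is `c · exp((5/8)(L - Lb))` on the domain and `ψ` vanishes off the domain
  have hint : ∫ z, ψ z * g z = c * ∫ z, ψ z * Complex.exp ((5 / 8 : ℂ) * (L z - Lb)) := by
    rw [← integral_const_mul]
    refine integral_congr_ae (Filter.Eventually.of_forall fun z => ?_)
    by_cases hz : z ∈ D.carrier
    · simp only [hid z hz]; ring
    · have hψz : ψ z = 0 := image_eq_zero_of_notMem_tsupport fun h => hz (hψD h)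
      simp only [hψz, zero_mul, mul_zero]
  have key := hw ψ hψ
  rw [hint] at key
  exact ⟨ms, key⟩

/-- **The composition (kernel-checked, no `sorry`)**: the seven stubs imply the crux
`BoundaryClosureR` BY NAME.  Given the antecedents `DefectDecoherence`, `MassRatio`: STUB 1 (fed by
STUB 2) gives the gate identities; STUB 4 (fed by STUB 1, the tightness conjunct of STUB 2, STUB 3,
the flat-ratio conjunct of STUB 6 and STUB 5's lower bounds) gives cup limits along subsequences and
the flat trace; STUB 7 (fed by STUBS 4, 6) identifies them; `closing` concludes. -/
theorem BoundaryClosureR_of (h1 : Registered.stub_gateRepresentation)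
    (h2 : Registered.stub_positiveMassLaws) (h3 : Registered.stub_l1Control)
    (h4 : Registered.stub_gateTrace) (h5 : Registered.stub_lowerBounds)
    (h6 : Registered.stub_ratioLaws) (h7 : Registered.stub_closing) :
    Summit.CriticalPhenomena.SAWScalingLimit.Theses.SAWDefectDecoherence.BoundaryClosureR :=
  fun hDD hMR =>
    have hS : GateSumRules := h1 hDD hMR h2
    have hR : RegularLimits := h4 hS h2.2.2 h3 h6.2.1 (h5 hDD hMR)
    closing hR.1 (h7 hR h6)

/-- Wiring check: the registered stubs feed `BoundaryClosureR_of` as stated. -/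
example : Summit.CriticalPhenomena.SAWScalingLimit.Theses.SAWDefectDecoherence.BoundaryClosureR :=
  BoundaryClosureR_of stub_gateRepresentation stub_positiveMassLaws stub_l1Control
    stub_gateTrace stub_lowerBounds stub_ratioLaws stub_closing

end Summit.CriticalPhenomena.SAWScalingLimit.Cruxes.BoundaryClosureR.DressedArrivalCauchyTransform

end
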